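import Summits.AnomalousDissipation.AnomalousDissipation.Theses.ImpulseGrid
import Summits.AnomalousDissipation.AnomalousDissipation.Theses.Correlation
import Summits.AnomalousDissipation.AnomalousDissipation.Theorems.ImpulseGridBoundedEnergyNoLeakGridOfRegularDriftStates
import Summits.AnomalousDissipation.AnomalousDissipation.Theorems.ImpulseGridBoundedEnergyNoLeakGridHardnessLH
import Summits.AnomalousDissipation.AnomalousDissipation.Theorems.BoundedEnergyNoLeakGrid.Negative.FalseOfEnergyUnboundedNegZM
import Literature.Analysis.FluidPDE.LongTimeAverageSubadditive
import Summits.AnomalousDissipation.AnomalousDissipation.Theorems.ImpulseGridBoundedEnergyNoLeakGridStubAbsorbingBallGrid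
import Summits.AnomalousDissipation.AnomalousDissipation.Theorems.ImpulseGridBoundedEnergyNoLeakGridOfNoMeanLeakage

/-!
# LEAD'S SKELETON v5 — line `Sketch` for crux `ImpulseGrid.BoundedEnergyNoLeakGrid`
(item stmt-AnomalousDissipation-14350, route route-AnomalousDissipation-ImpulseGrid;
continuation lead prover-line-stmt-AnomalousDissipation-14350-c5-0, 2026-08-16 (sixth seating); v1–v3 by lead …-14350-0, v4 by lead …-c1-0,
v5 by lead …-c2-0 — kept UNRESHAPED by c3, c4 and c5: UEDF is necessary for the crux, so no stub set with this composition can be easier;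
c4 added the resplit glues `GridThesis ⇐ (RegularDriftStates | UEDF ∧ Correlation.NoMeanLeakage) ∧ GridSignsLaw` as a --supports file;
c5 imports the landed regular door, the Leray–Hopf hardness file and the negative link so that §4 below states, sorry-free and BY NAME,
where the crux sits between the ledger's existing items: crux ⇒ stmt-14640 ⇒ stmt-14641 and stmt-14642 ⇒ ¬crux; c5 records the line as
dead in the L5 sense (`Lines/Sketch.dead.md`) and parks the crux `blocked-on: stmt-AnomalousDissipation-14640`)

History.  v1–v3: crux ⇐ `stub_classicalWitnessReduction` (LANDED p103646) ∘ `stub_galileanDriftTransfer` (LANDED p106921)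
∘ `stub_driftFrameBoundedFamilies` (residual).  v4: crux ⇐ `stub_regularDriftStatesSuffice` (LANDED p108824) ∘
`stub_regularDriftStatesExist` ("RegularDriftStates", residual; glue as ONE implication LANDED p109901
`Theorems.boundedEnergyNoLeakGrid_of_regularDriftStates`; hardness RegularDriftStates ⇒ Correlation.BoundedEnergyEqualityZM /
BoundedEnergyFamilyZM LANDED p109808).  Every v1–v4 residual asks for REGULAR (eternal classical) witnesses, which is MORE than
the crux needs: regularity was only the device that makes "no Leray–Hopf leakage" free.

v5 (this file) is the Leray–Hopf-level TIGHT factorisation.  The crux has two independent open halves and one provable clause: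

  crux ⇐ `stub_noMeanLeakageCapped`        (OPEN — no Leray–Hopf leakage in the mean at fixed ν > 0 for a forward-capped global
                                             Leray–Hopf solution under a smooth divergence-free mean-zero steady force; implied
                                             verbatim by the EXISTING crux `Correlation.NoMeanLeakage`, stmt-AnomalousDissipation-14265,
                                             see `noMeanLeakageCapped_of_NoMeanLeakage` below; FMRT2001 p.71)
       ∧ `stub_absorbingBallGrid`           (TRUE, provable now — the per-solution forward kinetic-energy cap at ν > 0,
                                             FMRT2001 (A.41)–(A.42); = the statement of Correlation.AbsorbingBallLHTorus, stmt-0447)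
       ∧ `stub_uniformEnergyDriftFamilies`  (OPEN, the RESIDUAL "UEDF": for every grid design, ν_j → 0⁺ and global Leray–Hopf
                                             families with drift datum `c e₀` and j-UNIFORMLY bounded mean energy — turbulent
                                             saturation `Re ~ Gr^{1/2}` for grid designs, DoeringFoias2002 §3, FMRT2001 (13.11)).

Unlike RegularDriftStates, UEDF is NECESSARY: `uniformEnergyDriftFamilies_of_boundedEnergyNoLeakGrid` (crux ⇒ UEDF, below,
sorry-free).  So v5 pins the crux:  UEDF ⇐ crux ⇐ UEDF ∧ stub_noMeanLeakageCapped ⇐ UEDF ∧ Correlation.NoMeanLeakage.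
The regular door survives unchanged: RegularDriftStates ⇒ crux (`regularDoor`, = p109901).

STATUS (v5, after waves 1–2): `stub_absorbingBallGrid` LANDED p110941 · `stub_noMeanLeakageCapped` OPEN, stub-blocked on
`Correlation.NoMeanLeakage` (stmt-14265; worker W2: no in-tree class-free proof, no junk loophole) · `stub_uniformEnergyDriftFamilies`
(UEDF) OPEN — the residual, NECESSARY (`uniformEnergyDriftFamilies_of_boundedEnergyNoLeakGrid`, LANDED p110786 with the iff form
`boundedEnergyNoLeakGrid_iff_uniformEnergyDriftFamilies` under stmt-14265 + stmt-0447) and CRUX-SIZED at the Leray–Hopf level: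
UEDF ⇒ `Correlation.BoundedEnergyFamilyZM` (stmt-14641) and crux ⇒ `Correlation.BoundedEnergyEqualityZM` (stmt-14640) by the Galilean
covariance of global Leray–Hopf solutions on `T³` (`Literature.Analysis.FluidPDE.Torus.IsGlobalLerayHopf.galilean_unboost_update`,
Literature files `LerayHopfGalileanTorus{Tools,Test,Weak,Energy,Continuity,Means}`, `LerayHopfSliceZeroTorus`; summit side
`Theorems/ImpulseGridBoundedEnergyNoLeakGridHardnessLH.lean`), and `Correlation.EnergyUnboundedNegZM` (stmt-14642) ⇒ ¬crux
(`Theorems/BoundedEnergyNoLeakGrid/Negative/`).  At `Φ ≡ 1` UEDF is EXACTLY zero-momentum saturation for the columnar pattern,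
independently of the drift (`Theorems/ImpulseGridBoundedEnergyNoLeakGridDriftSlice.lean`).
-/

-- the summit-side namespace repeats `AnomalousDissipation` by design (D-0017)
set_option linter.dupNamespace false

namespace Summit.AnomalousDissipation.AnomalousDissipation.Cruxes.BoundedEnergyNoLeakGrid.SweptSketch

open MeasureTheory Filter Set
open Literature.Analysis.FunctionSpaces Literature.Analysis.FunctionSpaces.Torus
open Literature.Analysis.FluidPDE Literature.Analysis.FluidPDE.Torus
open Summit.AnomalousDissipation.AnomalousDissipation.Theses.ImpulseGrid

local notation "𝕋³" => UnitAddTorus (Fin 3)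
local notation "E³" => EuclideanSpace ℝ (Fin 3)

/-! ## §1 Registered stubs (v5) -/

/-- **stub_absorbingBallGrid** (M; TRUE, provable now).  The absorbing ball / forward kinetic-energy cap of ONE global
Leray–Hopf solution on `T³` at fixed viscosity `ν > 0` under a smooth mean-zero steady force `f`: `∃ C ≥ 0, ∀ t ≥ 0,
½‖u(t)‖₂² ≤ C`.  Proof plan (Foias–Manley–Rosa–Temam 2001, App. II.A (A.41)–(A.42); Doering–Gibbon 1995 (5.3.38)):
momentum conservation `∫ u(t) = ∫ u₀` (mean-zero force, constant test fields), energy inequality from a.e. `s`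
(`IsLerayHopfOn.energy_ineq_ae`) with `(f, u) = (f, u − ū) ≤ ‖f‖₂‖∇u‖₂/(2π)` (Poincaré on the mean-free part, spectral
`eGradNormSq`), whence `½‖u(t)‖² ≤ max(½‖u₀‖², ½|ū₀|² + ‖f‖₂²/(32π⁴ν²)) + slack` by an integral Gronwall argument from a.e.
base points, and every `t` (not only a.e.) from `energy_ineq_zero`.  `C` may depend on `ν`, `f`, `u₀`.  (This is the statement
of the support item Correlation.AbsorbingBallLHTorus, stmt-AnomalousDissipation-0447, with `0 ≤ C` made explicit.) -/
theorem stub_absorbingBallGrid :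
    ∀ (ν : ℝ) (f : 𝕋³ → E³) (u₀ : 𝕋³ → E³) (u : ℝ → 𝕋³ → E³),
    0 < ν → IsSmooth f → HasZeroMean f → IsGlobalLerayHopf ν (fun _ => f) u₀ u →
    ∃ C : ℝ, 0 ≤ C ∧ ∀ t : ℝ, 0 ≤ t → kineticEnergy (u t) ≤ C :=
  -- LANDED p110941 (wave 1, worker W1)
  Summit.AnomalousDissipation.AnomalousDissipation.Theorems.BoundedEnergyNoLeakGrid.stub_absorbingBallGrid

/-- **stub_noMeanLeakageCapped** (OPEN — Leray–Hopf mean energy equality).  At fixed `ν > 0`, under a smooth divergence-free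
mean-zero steady force `f`, a global Leray–Hopf solution with a forward kinetic-energy cap does not leak energy in the mean:
`limsup_T (1/T)∫₀ᵀ (f, u) ≤ ν · limsup_T (1/T)∫₀ᵀ ‖∇u‖₂²` (the reverse inequality is the Leray–Hopf energy inequality).  Known
only for regular classes (Lions–Shinbrot `L⁴L⁴`, in tree `lions_energy_equality_Ioc`; Cheskidov–Constantin–Friedlander–Shvydkoy
2008 Thm 1.1); open in general (FMRT2001 p.71).  Implied verbatim by the existing crux `Correlation.NoMeanLeakage`
(stmt-AnomalousDissipation-14265): `noMeanLeakageCapped_of_NoMeanLeakage` below. -/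
theorem stub_noMeanLeakageCapped :
    ∀ (ν : ℝ) (f : 𝕋³ → E³) (u₀ : 𝕋³ → E³) (u : ℝ → 𝕋³ → E³),
    0 < ν → IsSmooth f → IsDivFree f → HasZeroMean f → IsGlobalLerayHopf ν (fun _ => f) u₀ u →
    (∃ C : ℝ, ∀ t : ℝ, 0 ≤ t → kineticEnergy (u t) ≤ C) →
    longTimeAvgSup (fun t => ∫ x, inner ℝ (f x) (u t x)) ≤ meanDissipation ν u := by
  sorry

/-- **stub_uniformEnergyDriftFamilies** ("UEDF"; OPEN, the RESIDUAL of the line, held by the lead — crux-sized and NECESSARY,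
`uniformEnergyDriftFamilies_of_boundedEnergyNoLeakGrid`).  For EVERY grid design `(Φ, G, c)` there are `ν_j → 0⁺`, data
`u₀ j` with drift `∫ u₀ j = c e₀` and global Leray–Hopf solutions `u j` of `NS_{ν_j}(Φ • G)` whose limsup-mean energies are
bounded uniformly in `j` (turbulent saturation `Re ~ Gr^{1/2}` instead of the laminar `Re ~ Gr`; Doering–Foias 2002 §3,
FMRT2001 (13.11)).  At the admissible design `Φ ≡ 1` it is, by the Galilean boost `x ↦ x − ct e₀` of Leray–Hopf solutions
(the swept force `G(· + ct e₀)` IS `G`), zero-momentum turbulent saturation for the fixed columnar force `G`, i.e. the open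
crux `Correlation.BoundedEnergyFamilyZM` (stmt-AnomalousDissipation-14641) uniformly in the pattern `G`. -/
theorem stub_uniformEnergyDriftFamilies :
    ∀ (Φ : 𝕋³ → ℝ) (G : 𝕋³ → E³) (c : ℝ), IsSmooth Φ → IsSmooth G →
    (∀ (s : UnitAddCircle) x, Φ (x + Pi.single (1 : Fin 3) s) = Φ x ∧ Φ (x + Pi.single (2 : Fin 3) s) = Φ x) →
    (∫ x, Φ x = 1) → (∀ (s : UnitAddCircle) x, G (x + Pi.single (0 : Fin 3) s) = G x) → (∀ x, G x 0 = 0) →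
    IsSmooth (fun x => Φ x • G x) → IsDivFree (fun x => Φ x • G x) → HasZeroMean (fun x => Φ x • G x) →
    0 < c →
    ∃ (ν : ℕ → ℝ) (u₀ : ℕ → 𝕋³ → E³) (u : ℕ → ℝ → 𝕋³ → E³),
      (∀ j, 0 < ν j) ∧ Filter.Tendsto ν Filter.atTop (nhds 0) ∧
      (∀ j, IsGlobalLerayHopf (ν j) (fun _ => fun x => Φ x • G x) (u₀ j) (u j)) ∧
      (∀ j, ∫ x, u₀ j x = c • EuclideanSpace.single 0 1) ∧
      (∃ E : ℝ, ∀ j, meanEnergy (u j) ≤ E) := by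
  sorry

/-! ## §2 Doors and necessity (sorry-free) -/

/-- **Necessity of the residual**: the crux implies UEDF (drop the per-`j` cap and the no-leak clause). -/
theorem uniformEnergyDriftFamilies_of_boundedEnergyNoLeakGrid (h : BoundedEnergyNoLeakGrid) :
    ∀ (Φ : 𝕋³ → ℝ) (G : 𝕋³ → E³) (c : ℝ), IsSmooth Φ → IsSmooth G →
    (∀ (s : UnitAddCircle) x, Φ (x + Pi.single (1 : Fin 3) s) = Φ x ∧ Φ (x + Pi.single (2 : Fin 3) s) = Φ x) →
    (∫ x, Φ x = 1) → (∀ (s : UnitAddCircle) x, G (x + Pi.single (0 : Fin 3) s) = G x) → (∀ x, G x 0 = 0) →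
    IsSmooth (fun x => Φ x • G x) → IsDivFree (fun x => Φ x • G x) → HasZeroMean (fun x => Φ x • G x) →
    0 < c →
    ∃ (ν : ℕ → ℝ) (u₀ : ℕ → 𝕋³ → E³) (u : ℕ → ℝ → 𝕋³ → E³),
      (∀ j, 0 < ν j) ∧ Filter.Tendsto ν Filter.atTop (nhds 0) ∧
      (∀ j, IsGlobalLerayHopf (ν j) (fun _ => fun x => Φ x • G x) (u₀ j) (u j)) ∧
      (∀ j, ∫ x, u₀ j x = c • EuclideanSpace.single 0 1) ∧
      (∃ E : ℝ, ∀ j, meanEnergy (u j) ≤ E) := by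
  intro Φ G c h1 h2 h3 h4 h5 h6 h7 h8 h9 h10
  obtain ⟨ν, u₀, u, hν, hν0, hLH, -, hdat, hE, -⟩ := h Φ G c h1 h2 h3 h4 h5 h6 h7 h8 h9 h10
  exact ⟨ν, u₀, u, hν, hν0, hLH, hdat, hE⟩

/-- **The no-leak stub is an instance of Correlation's crux `NoMeanLeakage`** (stmt-AnomalousDissipation-14265): drop the cap. -/
theorem noMeanLeakageCapped_of_NoMeanLeakage
    (h : Summit.AnomalousDissipation.AnomalousDissipation.Theses.Correlation.NoMeanLeakage) :
    ∀ (ν : ℝ) (f : 𝕋³ → E³) (u₀ : 𝕋³ → E³) (u : ℝ → 𝕋³ → E³),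
    0 < ν → IsSmooth f → IsDivFree f → HasZeroMean f → IsGlobalLerayHopf ν (fun _ => f) u₀ u →
    (∃ C : ℝ, ∀ t : ℝ, 0 ≤ t → kineticEnergy (u t) ≤ C) →
    longTimeAvgSup (fun t => ∫ x, inner ℝ (f x) (u t x)) ≤ meanDissipation ν u :=
  fun ν f u₀ u hν hf hdiv hzm hLH _ => h ν f u₀ u hν hf hdiv hzm hLH

/-- **The cap stub is the statement of Correlation's support item `AbsorbingBallLHTorus`** (stmt-AnomalousDissipation-0447),
with `0 ≤ C` explicit (enlarge `C` to `max C 0`). -/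
theorem absorbingBallGrid_of_AbsorbingBallLHTorus
    (h : Summit.AnomalousDissipation.AnomalousDissipation.Theses.Correlation.AbsorbingBallLHTorus) :
    ∀ (ν : ℝ) (f : 𝕋³ → E³) (u₀ : 𝕋³ → E³) (u : ℝ → 𝕋³ → E³),
    0 < ν → IsSmooth f → HasZeroMean f → IsGlobalLerayHopf ν (fun _ => f) u₀ u →
    ∃ C : ℝ, 0 ≤ C ∧ ∀ t : ℝ, 0 ≤ t → kineticEnergy (u t) ≤ C := by
  intro ν f u₀ u hν hf hzm hLH
  obtain ⟨C, hC⟩ := h ν f u₀ u hν hf hzm hLH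
  exact ⟨max C 0, le_max_right _ _, fun t ht => (hC t ht).trans (le_max_left _ _)⟩

-- The regular door (v1–v4) survives: RegularDriftStates ⇒ crux is the landed
-- `Summit.AnomalousDissipation.AnomalousDissipation.Theorems.boundedEnergyNoLeakGrid_of_regularDriftStates` (p109901).

/-! ## §3 Composition: the crux BY NAME -/

/-- **Composition** (pure logic): UEDF gives the family; the cap stub gives the per-`j` sup-energy bound at `ν_j > 0`; the
no-leak stub gives the last clause. -/
theorem BoundedEnergyNoLeakGrid_of : BoundedEnergyNoLeakGrid := by
  intro Φ G c h1 h2 h3 h4 h5 h6 h7 h8 h9 h10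
  obtain ⟨ν, u₀, u, hν, hν0, hLH, hdat, E, hE⟩ :=
    stub_uniformEnergyDriftFamilies Φ G c h1 h2 h3 h4 h5 h6 h7 h8 h9 h10
  have hcap : ∀ j, ∃ C : ℝ, ∀ t : ℝ, 0 ≤ t → kineticEnergy (u j t) ≤ C := fun j => by
    obtain ⟨C, -, hC⟩ := stub_absorbingBallGrid (ν j) (fun x => Φ x • G x) (u₀ j) (u j) (hν j) h7 h9 (hLH j)
    exact ⟨C, hC⟩
  exact ⟨ν, u₀, u, hν, hν0, hLH, hcap, hdat, ⟨E, hE⟩, fun j =>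
    stub_noMeanLeakageCapped (ν j) (fun x => Φ x • G x) (u₀ j) (u j) (hν j) h7 h8 h9 (hLH j) (hcap j)⟩

/-! ## §4 Position of the crux among the ledger's EXISTING items (sorry-free, by name; lead c5)

The two open stubs are not artefacts of this line: they are the crux.  The landed files below pin it between items of
route Correlation, which is why c5 parks the crux `blocked-on: stmt-AnomalousDissipation-14640`. -/

/-- **crux ⇒ stmt-14640** (`Correlation.BoundedEnergyEqualityZM`, `[open-problem]`): the crux's Φ ≡ 1 specialisation, by the
Galilean covariance of global Leray–Hopf solutions (LANDED p118293).  The crux cannot close before stmt-14640 does. -/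
theorem crux_implies_boundedEnergyEqualityZM :
    BoundedEnergyNoLeakGrid → Summit.AnomalousDissipation.AnomalousDissipation.Theses.Correlation.BoundedEnergyEqualityZM :=
  Summit.AnomalousDissipation.AnomalousDissipation.Theorems.boundedEnergyEqualityZM_of_boundedEnergyNoLeakGrid

/-- **crux ⇒ stmt-14641** (`Correlation.BoundedEnergyFamilyZM`, `[open-problem]`; turbulent saturation at zero momentum),
through the necessary residual UEDF (LANDED p118293). -/
theorem crux_implies_boundedEnergyFamilyZM :
    BoundedEnergyNoLeakGrid → Summit.AnomalousDissipation.AnomalousDissipation.Theses.Correlation.BoundedEnergyFamilyZM :=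
  Summit.AnomalousDissipation.AnomalousDissipation.Theorems.boundedEnergyFamilyZM_of_boundedEnergyNoLeakGrid

/-- **stmt-14642 ⇒ ¬crux** (`Correlation.EnergyUnboundedNegZM`; LANDED p119194 under `Theorems/BoundedEnergyNoLeakGrid/Negative/`). -/
theorem not_crux_of_energyUnboundedNegZM :
    Summit.AnomalousDissipation.AnomalousDissipation.Theses.Correlation.EnergyUnboundedNegZM → ¬ BoundedEnergyNoLeakGrid :=
  Summit.AnomalousDissipation.AnomalousDissipation.Theorems.BoundedEnergyNoLeakGrid_false_of_EnergyUnboundedNegZM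

/-- **¬stmt-14640 ⇒ ¬crux**: a refutation of the parking item refutes the crux (contrapositive of p118293). -/
theorem not_crux_of_not_boundedEnergyEqualityZM :
    ¬ Summit.AnomalousDissipation.AnomalousDissipation.Theses.Correlation.BoundedEnergyEqualityZM → ¬ BoundedEnergyNoLeakGrid :=
  mt crux_implies_boundedEnergyEqualityZM

/-- **The regular door** (v1–v4; LANDED p109901): bounded ETERNAL REGULAR drift states for every grid design give the crux with the
no-leak clause for free — the one-conjecture reading the planner may resplit GridThesis into (c4 (A), glue p121276). -/
theorem regularDoor :
    (∀ (Φ : 𝕋³ → ℝ) (G : 𝕋³ → E³) (c : ℝ), IsSmooth Φ → IsSmooth G →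
      (∀ (s : UnitAddCircle) x, Φ (x + Pi.single (1 : Fin 3) s) = Φ x ∧ Φ (x + Pi.single (2 : Fin 3) s) = Φ x) →
      (∫ x, Φ x = 1) → (∀ (s : UnitAddCircle) x, G (x + Pi.single (0 : Fin 3) s) = G x) → (∀ x, G x 0 = 0) →
      IsSmooth (fun x => Φ x • G x) → IsDivFree (fun x => Φ x • G x) → HasZeroMean (fun x => Φ x • G x) →
      0 < c →
      ∃ (ν : ℕ → ℝ) (u : ℕ → ℝ → 𝕋³ → E³) (p : ℕ → ℝ → 𝕋³ → ℝ),
        (∀ j, 0 < ν j) ∧ Tendsto ν atTop (nhds 0) ∧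
        (∀ j, IsClassicalNSSolutionOn Set.univ (ν j) (fun _ => fun x => Φ x • G x) (u j) (p j)) ∧
        (∀ j, ∫ x, u j 0 x = c • EuclideanSpace.single (0 : Fin 3) (1 : ℝ)) ∧
        (∀ j, ∃ C : ℝ, ∀ t : ℝ, 0 ≤ t → kineticEnergy (u j t) ≤ C) ∧
        (∃ E : ℝ, ∀ j, meanEnergy (u j) ≤ E)) →
    BoundedEnergyNoLeakGrid :=
  Summit.AnomalousDissipation.AnomalousDissipation.Theorems.boundedEnergyNoLeakGrid_of_regularDriftStates

/-- **The Leray–Hopf door under Correlation.NoMeanLeakage** (stmt-14265; LANDED p120437): with LH mean energy equality granted,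
the crux is EXACTLY the residual UEDF (c4 (B), glue p121276). -/
theorem lhDoor_iff (hNL : Summit.AnomalousDissipation.AnomalousDissipation.Theses.Correlation.NoMeanLeakage) :
    BoundedEnergyNoLeakGrid ↔
    (∀ (Φ : 𝕋³ → ℝ) (G : 𝕋³ → E³) (c : ℝ), IsSmooth Φ → IsSmooth G →
      (∀ (s : UnitAddCircle) x, Φ (x + Pi.single (1 : Fin 3) s) = Φ x ∧ Φ (x + Pi.single (2 : Fin 3) s) = Φ x) →
      (∫ x, Φ x = 1) → (∀ (s : UnitAddCircle) x, G (x + Pi.single (0 : Fin 3) s) = G x) → (∀ x, G x 0 = 0) →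
      IsSmooth (fun x => Φ x • G x) → IsDivFree (fun x => Φ x • G x) → HasZeroMean (fun x => Φ x • G x) →
      0 < c →
      ∃ (ν : ℕ → ℝ) (u₀ : ℕ → 𝕋³ → E³) (u : ℕ → ℝ → 𝕋³ → E³),
        (∀ j, 0 < ν j) ∧ Filter.Tendsto ν Filter.atTop (nhds 0) ∧
        (∀ j, IsGlobalLerayHopf (ν j) (fun _ => fun x => Φ x • G x) (u₀ j) (u j)) ∧
        (∀ j, ∫ x, u₀ j x = c • EuclideanSpace.single 0 1) ∧
        (∃ E : ℝ, ∀ j, meanEnergy (u j) ≤ E)) :=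
  Summit.AnomalousDissipation.AnomalousDissipation.Theorems.boundedEnergyNoLeakGrid_iff_uedf_of_noMeanLeakage hNL

end Summit.AnomalousDissipation.AnomalousDissipation.Cruxes.BoundedEnergyNoLeakGrid.SweptSketch
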